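import Summits.ResolutionOfSingularities.ResolutionOfSingularities.Theorems.FrobeniusLadderFInjectiveMacaulayficationTwoLevelTower
import Summits.ResolutionOfSingularities.ResolutionOfSingularities.Theorems.FrobeniusLadderFInjectiveMacaulayficationTwoLevelTowerLevelOne
import Literature.AlgebraicGeometry.Resolution.AffineBlowupUnique
import Literature.AlgebraicGeometry.Resolution.AffineBlowupUniversal
import Literature.AlgebraicGeometry.Resolution.AffineBlowupIntegral
import Literature.AlgebraicGeometry.Resolution.BlowupsExistence
import HarnessLib

/-!
# E7 — THE TWO-LEVEL FRAME over an affine base: `PFix` at a closed point from a toric/Rees first step, a bad curve `closure {ξ}`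
# in its fibre, level-1 chart clauses off the curve and level-2 certificates on the charts through the curve
# (crux `FInjectiveMacaulayfication` stmt-ResolutionOfSingularities-15315, chain w45a; E7 CERT FORMAT `two-level-tower-cert-v1` §0/§2)

[OURS · L1 W4.5a · res-L1-w45a-lead-1 gen 4] Support file (`--supports stmt-ResolutionOfSingularities-15315 --as helper`) for the
crux `FrobeniusLadder.FInjectiveMacaulayfication`; NOT a statement of any manuscript; AI-written, weaker than expert review.

THE THEOREM (`pointFixable_of_twoLevelData`) — the data-independent half of every two-level instance (T₁₁/3 first). INPUT:
a Noetherian domain `R` of characteristic `p`, a nonzero ideal `I` whose radical is the closed point `b` (the level-1 centre, e.g.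
the fan's monomial ideal `I_A · R`), a point `ξ` of `X′ := affineBlowup I` over `b` (the generic point of the bad curve; the second
centre is `J₂ := 𝓘(closure {ξ})`, res-type-002's N5b `IdealSheafOfPointClosure`), a family of affine opens `U c` covering `X′`
(the Rees = toric charts, res-type-034's N5a `AffineBlowupChartFrame`) with Jacobson Noetherian domain sections of characteristic `p`
and fibre ideals `𝔟 c` characterising the points over `b` (N4b/N4c `FibreIdealOfBasePoint` / `FibreIdealOfOrigin`), LEVEL-1
CERTIFICATES = the Cohen–Macaulay + Frobenius-closed clause at `Γ(X′,U c)_Q` for every maximal `Q ⊇ 𝔟 c` not containing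
`J₂(U c)` (cells «over b minus V(P_c)», N5c), and on a sub-family `S` of charts covering `closure {ξ}` the LEVEL-2 data of N4/N4′
(generators `v σ` of `J₂(U σ)`, Rees cover `hcov`, and `hon σ j`: the clause at the exceptional maximal points over `b` of
`Bl_{J₂(U σ)}` — cells «over b on E» through res-type-034's N3 `TranslatedRelativeCN`). OUTPUT: `PFix_p(𝒪_{Spec R, b})` in the 5e /
`h0` currency (an `𝔪_b`-primary centre `(c)` whose affine blow-up charts satisfy the FULL clause at every prime over `𝔪_b`).
PROOF = bookkeeping around the landed engine: `b` closed; `J₁ := affineBlowup.idealSheaf I` is finitely generated, nonzero, supported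
exactly at `b` (`affineBlowup.support_idealSheaf`); `π₁ := affineBlowup.π I` is its blow-up (`affineBlowup.isBlowup`); `X′` is
Noetherian with characteristic-`p` stalks; `J₂ ≠ ⊥` (`closure {ξ} ⊆ π₁⁻¹ b ≠ X′` by `affineBlowup.surjective`), supported over
`b`; a blow-up `π₂ : X″ ⟶ X′` along `J₂` exists (`exists_isBlowup`, GW 13.92); level 1 ⇒ `hoffStalk` by N5d
`TwoLevelTowerLevelOne.stalkClause_off_support_of_chartClauses`; `hoff σ` on the hon charts by `TwoLevelTower.chartClause_of_stalkClause`;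
then N4′ `TwoLevelTower.pointFixable_of_twoLevelTower_suppCover` (∘ 5h). No named facts. [folklore]
-/

-- single-problem summit: the doubled namespace component is forced
set_option linter.dupNamespace false

noncomputable section

namespace Summit.ResolutionOfSingularities.ResolutionOfSingularities.Theorems.FInjectiveMacaulayfication.TwoLevelFrame

open AlgebraicGeometry CategoryTheory TopologicalSpace Literature.AlgebraicGeometry.Resolution
open Summit.ResolutionOfSingularities.ResolutionOfSingularities.Theorems.FInjectiveMacaulayfication

/-- **E7 two-level frame — `PFix_p(𝒪_{Spec R, b})` from two-level data over an affine base.** See the module docstring for the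
roles of the binders (level-1 centre `I`, bad curve `closure {ξ}`, all charts `U` with fibre ideals `𝔟` and chart clauses off the
curve, hon charts `S` with N4′'s level-2 data). [folklore] -/
theorem pointFixable_of_twoLevelData (p : ℕ) [Fact p.Prime]
    (R : Type) [CommRing R] [IsDomain R] [IsNoetherianRing R] [CharP R p]
    (I : Ideal R) (hI0 : I ≠ ⊥) (b : ↥(Spec (.of R))) (hbmax : b.asIdeal.IsMaximal) (hIb : I.radical = b.asIdeal)
    -- the generic point of the bad curve, over `b`
    (ξ : ↥(affineBlowup I)) (hξ : (affineBlowup.π I).base ξ = b)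
    -- all charts of `X′ = affineBlowup I` (level 1)
    {ι : Type} (U : ι → (affineBlowup I).affineOpens) (hUcover : ∀ x' : ↥(affineBlowup I), ∃ c : ι, x' ∈ (U c : (affineBlowup I).Opens))
    (hdom : ∀ c : ι, IsDomain Γ(affineBlowup I, U c)) (hnoeth : ∀ c : ι, IsNoetherianRing Γ(affineBlowup I, U c))
    (hjac : ∀ c : ι, IsJacobsonRing Γ(affineBlowup I, U c)) (hchar : ∀ c : ι, CharP Γ(affineBlowup I, U c) p)
    (𝔟 : ∀ c : ι, Ideal Γ(affineBlowup I, U c))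
    (h𝔟 : ∀ (c : ι) (z : ↥(Spec Γ(affineBlowup I, U c))), (affineBlowup.π I).base ((U c).2.fromSpec.base z) = b → 𝔟 c ≤ z.asIdeal)
    (h𝔟' : ∀ (c : ι) (z : ↥(Spec Γ(affineBlowup I, U c))), 𝔟 c ≤ z.asIdeal → (affineBlowup.π I).base ((U c).2.fromSpec.base z) = b)
    -- LEVEL-1 CERTIFICATES: the clause at the maximal ideals over `b` off the bad curve, chart by chart
    (hchart : ∀ (c : ι) (Q : Ideal Γ(affineBlowup I, U c)) [Q.IsMaximal],
      ¬ (Scheme.IdealSheafData.vanishingIdeal (⟨closure ({ξ} : Set ↥(affineBlowup I)), isClosed_closure⟩ :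
          Closeds ↥(affineBlowup I))).ideal (U c) ≤ Q → 𝔟 c ≤ Q →
      ∀ d : ℕ, ringKrullDim (Localization.AtPrime Q) = d → ∀ s : Fin d → Localization.AtPrime Q,
        (Ideal.span (Set.range s)).radical.IsMaximal →
          RingTheory.Sequence.IsWeaklyRegular (Localization.AtPrime Q) (List.ofFn s) ∧
          ∀ y : Localization.AtPrime Q, (∃ e : ℕ, y ^ p ^ e ∈ Ideal.span
            ((fun z : Localization.AtPrime Q => z ^ p ^ e) ''
              (Ideal.span (Set.range s) : Set (Localization.AtPrime Q)))) → y ∈ Ideal.span (Set.range s))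
    -- HON CHARTS: a sub-family covering the bad curve, with N4/N4′'s level-2 data
    (S : Set ι) (hScover : ∀ x' : ↥(affineBlowup I), x' ∈ closure ({ξ} : Set ↥(affineBlowup I)) → ∃ c ∈ S, x' ∈ (U c : (affineBlowup I).Opens))
    (t : S → ℕ) (v : ∀ σ : S, Fin (t σ) → Γ(affineBlowup I, U σ))
    (hv : ∀ (σ : S) (j : Fin (t σ)), v σ j ∈ (Scheme.IdealSheafData.vanishingIdeal (⟨closure ({ξ} : Set ↥(affineBlowup I)), isClosed_closure⟩ :
          Closeds ↥(affineBlowup I))).ideal (U σ))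
    (hv0 : ∀ (σ : S) (j : Fin (t σ)), v σ j ≠ 0)
    (hcov : ∀ σ : S, (HomogeneousIdeal.irrelevant (reesGrading ((Scheme.IdealSheafData.vanishingIdeal
        (⟨closure ({ξ} : Set ↥(affineBlowup I)), isClosed_closure⟩ : Closeds ↥(affineBlowup I))).ideal (U σ)))).toIdeal ≤
      (Ideal.span (Set.range fun j : Fin (t σ) => reesT (I := (Scheme.IdealSheafData.vanishingIdeal
        (⟨closure ({ξ} : Set ↥(affineBlowup I)), isClosed_closure⟩ : Closeds ↥(affineBlowup I))).ideal (U σ)) (v σ j) (hv σ j))).radical)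
    -- LEVEL-2 CERTIFICATES: the clause at the exceptional maximal points over `b`, hon chart by hon chart
    (hon : ∀ (σ : S) (j : Fin (t σ)) (Q : Ideal (blowupAlgebra ((Scheme.IdealSheafData.vanishingIdeal
        (⟨closure ({ξ} : Set ↥(affineBlowup I)), isClosed_closure⟩ : Closeds ↥(affineBlowup I))).ideal (U σ)) (v σ j))) [Q.IsMaximal],
      algebraMap Γ(affineBlowup I, U σ) _ (v σ j) ∈ Q → (𝔟 σ).map (algebraMap Γ(affineBlowup I, U σ) _) ≤ Q →
      ∀ d : ℕ, ringKrullDim (Localization.AtPrime Q) = d → ∀ s : Fin d → Localization.AtPrime Q,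
        (Ideal.span (Set.range s)).radical.IsMaximal →
          RingTheory.Sequence.IsWeaklyRegular (Localization.AtPrime Q) (List.ofFn s) ∧
          ∀ y : Localization.AtPrime Q, (∃ e : ℕ, y ^ p ^ e ∈ Ideal.span
            ((fun z : Localization.AtPrime Q => z ^ p ^ e) ''
              (Ideal.span (Set.range s) : Set (Localization.AtPrime Q)))) → y ∈ Ideal.span (Set.range s)) :
    ∃ (n : ℕ) (c : Fin n → (Spec (.of R)).presheaf.stalk b), Ideal.span (Set.range c) ≠ ⊥ ∧
      (Ideal.span (Set.range c)).radical = IsLocalRing.maximalIdeal ((Spec (.of R)).presheaf.stalk b) ∧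
      ∀ (j : Fin n) (𝔔 : PrimeSpectrum (blowupAlgebra (Ideal.span (Set.range c)) (c j))),
        𝔔.asIdeal.comap (algebraMap ((Spec (.of R)).presheaf.stalk b) (blowupAlgebra (Ideal.span (Set.range c)) (c j))) =
          IsLocalRing.maximalIdeal ((Spec (.of R)).presheaf.stalk b) →
        IsDomain (Localization.AtPrime 𝔔.asIdeal) ∧ ∀ d : ℕ, ringKrullDim (Localization.AtPrime 𝔔.asIdeal) = d →
          ∀ s : Fin d → Localization.AtPrime 𝔔.asIdeal, (Ideal.span (Set.range s)).radical.IsMaximal →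
            RingTheory.Sequence.IsWeaklyRegular (Localization.AtPrime 𝔔.asIdeal) (List.ofFn s) ∧
            ∀ y : Localization.AtPrime 𝔔.asIdeal, (∃ e : ℕ, y ^ p ^ e ∈ Ideal.span
              ((fun z : Localization.AtPrime 𝔔.asIdeal => z ^ p ^ e) ''
                (Ideal.span (Set.range s) : Set (Localization.AtPrime 𝔔.asIdeal)))) → y ∈ Ideal.span (Set.range s) := by
  classical
  have hp : p.Prime := Fact.out
  -- `b` is a closed point
  have hb : IsClosed ({b} : Set ↥(Spec (.of R))) := (PrimeSpectrum.isClosed_singleton_iff_isMaximal b).mpr hbmax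
  haveI : IsNoetherianRing (CommRingCat.of R) := inferInstanceAs (IsNoetherianRing R)
  haveI : IsLocallyNoetherian (Spec (.of R)) := inferInstance
  -- `J₁ := affineBlowup.idealSheaf I` is finitely generated, nonzero, supported exactly at `b`; `π₁` is its blow-up
  have hJ₁fg : ∀ W : (Spec (.of R)).affineOpens, ((affineBlowup.idealSheaf I).ideal W).FG := fun W => by
    haveI : IsNoetherianRing Γ(Spec (.of R), W) := IsLocallyNoetherian.component_noetherian W
    exact IsNoetherian.noetherian _
  have hsupp₁ : ((affineBlowup.idealSheaf I).support : Set ↥(Spec (.of R))) = {b} := by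
    refine Set.eq_singleton_iff_unique_mem.mpr ⟨?_, fun x hx => ?_⟩
    · rw [affineBlowup.support_idealSheaf]
      change (I : Set R) ⊆ b.asIdeal
      rw [← hIb]
      exact Ideal.le_radical
    · rw [affineBlowup.support_idealSheaf] at hx
      have hx' : I ≤ x.asIdeal := hx
      have h2 : b.asIdeal ≤ x.asIdeal := by
        rw [← hIb]
        exact (x.2.radical_le_iff).mpr hx'
      exact PrimeSpectrum.ext ((hbmax.eq_of_le x.2.ne_top h2).symm)
  -- `b` is not the generic point (`I ≠ ⊥`)
  have hbne : b.asIdeal ≠ ⊥ := by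
    intro h3
    apply hI0
    rw [← le_bot_iff, ← h3, ← hIb]
    exact Ideal.le_radical
  have hJ₁ : affineBlowup.idealSheaf I ≠ ⊥ := by
    intro h
    have h1 : (⟨⊥, Ideal.isPrime_bot⟩ : ↥(Spec (.of R))) ∈ ((affineBlowup.idealSheaf I).support : Set ↥(Spec (.of R))) := by
      rw [h, Scheme.IdealSheafData.support_bot]; trivial
    rw [hsupp₁] at h1
    have h2 : (⟨⊥, Ideal.isPrime_bot⟩ : ↥(Spec (.of R))) = b := h1
    exact hbne (by rw [← h2])
  have hπ₁ : IsBlowup (affineBlowup.π I) (affineBlowup.idealSheaf I) := affineBlowup.isBlowup I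
  -- `X′` is Noetherian with characteristic-`p` stalks
  haveI : IsLocallyNoetherian (affineBlowup I) := LocallyOfFiniteType.isLocallyNoetherian (affineBlowup.π I)
  have hcharStalk : ∀ x' : ↥(affineBlowup I), CharP ((affineBlowup I).presheaf.stalk x') p := fun x' =>
    CharP.of_ringHom_of_ne_zero
      (((affineBlowup I).presheaf.germ ⊤ x' trivial).hom.comp
        ((affineBlowup.π I).appTop.hom.comp (Scheme.ΓSpecIso (.of R)).inv.hom)) p hp.ne_zero
  -- `J₂` finitely generated, nonzero, supported over `b`
  have hJ₂fg : ∀ W : (affineBlowup I).affineOpens, ((Scheme.IdealSheafData.vanishingIdeal (⟨closure ({ξ} : Set ↥(affineBlowup I)), isClosed_closure⟩ : Closeds ↥(affineBlowup I))).ideal W).FG := fun W => by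
    haveI : IsNoetherianRing Γ(affineBlowup I, W) := IsLocallyNoetherian.component_noetherian W
    exact IsNoetherian.noetherian _
  have hsupp₂ : ((Scheme.IdealSheafData.vanishingIdeal (⟨closure ({ξ} : Set ↥(affineBlowup I)), isClosed_closure⟩ : Closeds ↥(affineBlowup I))).support : Set ↥(affineBlowup I)) ⊆ (affineBlowup.π I).base ⁻¹' {b} := by
    rw [IdealSheafOfPointClosure.coe_support]
    exact closure_minimal (Set.singleton_subset_iff.mpr hξ) (hb.preimage (affineBlowup.π I).base.hom.continuous)
  have hJ₂ : (Scheme.IdealSheafData.vanishingIdeal (⟨closure ({ξ} : Set ↥(affineBlowup I)), isClosed_closure⟩ : Closeds ↥(affineBlowup I))) ≠ ⊥ := by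
    refine IdealSheafOfPointClosure.ne_bot ξ fun huniv => ?_
    -- a point of `X′` over the generic point of `Spec R` would lie in `closure {ξ} ⊆ π₁⁻¹ b`
    obtain ⟨x', hx'⟩ := affineBlowup.surjective hI0 (⟨⊥, Ideal.isPrime_bot⟩ : ↥(Spec (.of R)))
    have h1 : x' ∈ closure ({ξ} : Set ↥(affineBlowup I)) := by rw [huniv]; trivial
    have h2 : (affineBlowup.π I).base x' ∈ ({b} : Set ↥(Spec (.of R))) := by
      apply hsupp₂
      rw [IdealSheafOfPointClosure.coe_support]
      exact h1
    have h2' : (affineBlowup.π I).base x' = b := h2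
    have h3 : (affineBlowup.π I).base x' = (⟨⊥, Ideal.isPrime_bot⟩ : ↥(Spec (.of R))) := hx'
    exact hbne (by rw [← h2', h3])
  -- a blowing up of `X′` along `J₂`
  obtain ⟨X'', π₂, hπ₂⟩ := exists_isBlowup (affineBlowup I) (Scheme.IdealSheafData.vanishingIdeal (⟨closure ({ξ} : Set ↥(affineBlowup I)), isClosed_closure⟩ : Closeds ↥(affineBlowup I)))
  -- LEVEL 1 ⇒ `hoffStalk` (N5d)
  have hoffStalk := TwoLevelTowerLevelOne.stalkClause_off_support_of_chartClauses p (Spec (.of R)) (affineBlowup I)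
    (affineBlowup.π I) b (Scheme.IdealSheafData.vanishingIdeal (⟨closure ({ξ} : Set ↥(affineBlowup I)), isClosed_closure⟩ : Closeds ↥(affineBlowup I))) hcharStalk U (fun x' _ _ => hUcover x') hdom hjac 𝔟 h𝔟 (fun c Q _ hQJ hQb => hchart c Q hQJ hQb)
  -- `hoff σ` on the hon charts, from `hoffStalk` (rev 3 `chartClause_of_stalkClause`)
  have hoffS : ∀ (σ : S) (Q : Ideal Γ(affineBlowup I, U σ)) [Q.IsMaximal], ¬ (Scheme.IdealSheafData.vanishingIdeal (⟨closure ({ξ} : Set ↥(affineBlowup I)), isClosed_closure⟩ : Closeds ↥(affineBlowup I))).ideal (U σ) ≤ Q → 𝔟 σ ≤ Q →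
      ∀ d : ℕ, ringKrullDim (Localization.AtPrime Q) = d → ∀ s : Fin d → Localization.AtPrime Q,
        (Ideal.span (Set.range s)).radical.IsMaximal →
          RingTheory.Sequence.IsWeaklyRegular (Localization.AtPrime Q) (List.ofFn s) ∧
          ∀ y : Localization.AtPrime Q, (∃ e : ℕ, y ^ p ^ e ∈ Ideal.span
            ((fun z : Localization.AtPrime Q => z ^ p ^ e) ''
              (Ideal.span (Set.range s) : Set (Localization.AtPrime Q)))) → y ∈ Ideal.span (Set.range s) :=
    fun σ Q _ hQJ hQb => (TwoLevelTower.chartClause_of_stalkClause p (Spec (.of R)) (affineBlowup I) (affineBlowup.π I) b (Scheme.IdealSheafData.vanishingIdeal (⟨closure ({ξ} : Set ↥(affineBlowup I)), isClosed_closure⟩ : Closeds ↥(affineBlowup I)))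
      (U σ) (𝔟 σ) (h𝔟' σ) hoffStalk Q hQJ hQb).2
  -- N4′ ∘ 5h
  exact TwoLevelTower.pointFixable_of_twoLevelTower_suppCover p (Spec (.of R)) b hb (affineBlowup.idealSheaf I) hJ₁fg hJ₁ hsupp₁
    (affineBlowup I) (affineBlowup.π I) hπ₁ (Scheme.IdealSheafData.vanishingIdeal (⟨closure ({ξ} : Set ↥(affineBlowup I)), isClosed_closure⟩ : Closeds ↥(affineBlowup I))) hJ₂fg hJ₂ hsupp₂ X'' π₂ hπ₂
    hoffStalk (fun σ : S => U σ)
    (fun x' _ hx' => by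
      have hx'c : x' ∈ closure ({ξ} : Set ↥(affineBlowup I)) := by
        rw [← IdealSheafOfPointClosure.coe_support ξ]; exact hx'
      obtain ⟨c, hcS, hxc⟩ := hScover x' hx'c
      exact ⟨⟨c, hcS⟩, hxc⟩)
    (fun σ => hdom σ) (fun σ => hnoeth σ) (fun σ => hjac σ) (fun σ => hchar σ) (fun σ => 𝔟 σ) (fun σ z hz => h𝔟 σ z hz)
    t v hv hv0 hcov hoffS hon

end Summit.ResolutionOfSingularities.ResolutionOfSingularities.Theorems.FInjectiveMacaulayfication.TwoLevelFrame

end
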